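import Summits.AtomisticToContinuum.HydrodynamicLimit.Theorems.DiffuseBackwardInfluence.Negative.FreeDirection

/-!
# `DiffuseBackwardInfluence`: the transfer is orthogonal — row budget `Σ_k a_ik = 3`, floor `9/(N+1)`, unit swap
(negative knowledge / load-bearing analysis for crux stmt-AtomisticToContinuum-12950, disprover cycle 2, finding F9)

The crux's frozen-geometry transfer `M = transfer σ N y Δ` is LINEAR (`transfer_add/smul`: `reflectVel` is linear in the
velocity pair), ENERGY-PRESERVING (`sum_norm_sq_transfer`, from `configEnergy_collidePair`) and INVERTIBLE by the same
reflections in reverse order (`transfer_untransfer`, from the involution `step_step`), hence ORTHOGONAL for the `ℓ²`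
pairing `bil` (`bil_transfer_left`: `⟨M W, W'⟩ = ⟨W, M⁻¹ W'⟩`). Consequences for every line on this crux:
* ROW BUDGET `Σ_k Σ_a ‖M (e_k ⊗ e_a) i‖² = 3` (`rowBudget`; the fourth conjunct of the support item `TransferIsometry`,
  stmt-12951, in the landed vocabulary), whence `rowIpr_i, ipr ∈ [9/(N+1), 9]` (`floor_le_rowIpr`, `rowIpr_le_nine`,
  `floor_le_ipr`, `ipr_le_nine`): the functional is bounded and its target `0` is approached at best at the Haar rate;
* UNIT SWAP `Σ_k Σ_a ⟨ν, M (e_k ⊗ e_a) p⟩² = 1` for every row `p` and unit `ν` (`sum_inner_sq_transfer_eq_one`): at a fold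
  step the transferred normal weights `x_k = ‖P_ν M_pk‖_F²` form a probability vector over the sources, whatever the
  history (the kinship / gossip lines' bookkeeping input, here a theorem).
-/

namespace Summit.AtomisticToContinuum.HydrodynamicLimit.Theorems.DiffuseBackwardInfluenceNeg

open scoped BigOperators Topology ENNReal InnerProductSpace
open Filter Set MeasureTheory
open Literature.Analysis.FluidPDE Literature.MathematicalPhysics.KineticTheory
open Summit.AtomisticToContinuum.HydrodynamicLimit.Theses.CollisionIsometryCLT

noncomputable section

/-! ## §1 The reflection law is linear in the velocity pair -/

/-- Additivity of the elastic reflection in the velocity pair (fixed impact direction). [folklore] -/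
theorem reflectVel_add (n : V3) (p p' : V3 × V3) :
    reflectVel n (p + p') = reflectVel n p + reflectVel n p' := by
  have hc : ⟪(p + p').1 - (p + p').2, n⟫_ℝ / ‖n‖ ^ 2 =
      ⟪p.1 - p.2, n⟫_ℝ / ‖n‖ ^ 2 + ⟪p'.1 - p'.2, n⟫_ℝ / ‖n‖ ^ 2 := by
    rw [← add_div, ← inner_add_left, Prod.fst_add, Prod.snd_add]
    congr 2
    abel
  unfold reflectVel
  rw [hc]
  refine Prod.ext ?_ ?_
  · simp only [Prod.fst_add, add_smul]
    abel
  · simp only [Prod.snd_add, add_smul]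
    abel

/-- Homogeneity of the elastic reflection in the velocity pair (fixed impact direction). [folklore] -/
theorem reflectVel_const_smul (n : V3) (c : ℝ) (p : V3 × V3) :
    reflectVel n (c • p) = c • reflectVel n p := by
  have hc : ⟪(c • p).1 - (c • p).2, n⟫_ℝ / ‖n‖ ^ 2 = c * (⟪p.1 - p.2, n⟫_ℝ / ‖n‖ ^ 2) := by
    rw [Prod.smul_fst, Prod.smul_snd, ← smul_sub, real_inner_smul_left, mul_div_assoc]
  unfold reflectVel
  rw [hc]
  refine Prod.ext ?_ ?_
  · simp only [Prod.smul_fst, Prod.smul_mk, smul_sub, smul_smul]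
  · simp only [Prod.smul_snd, Prod.smul_mk, smul_add, smul_smul]

/-! ## §2 The fold step: explicit form, linearity, energy -/

section Step

variable {σ : ℝ} {N : ℕ}

/-- The two members of a reflected pair are distinct. [folklore] -/
theorem some_fst_ne_some_snd {y : Cfg N} {k : ℕ} (h : (pairsAt σ N y k).Nonempty) : h.some.1 ≠ h.some.2 :=
  ne_of_lt (Alexander.mem_incomingPairs.1 h.some_mem).1

/-- The fold step at the first member of the reflected pair. [folklore] -/
theorem step_apply_some_fst {y : Cfg N} {k : ℕ} (h : (pairsAt σ N y k).Nonempty) (W : Fin (N + 1) → V3) :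
    step σ N y W k h.some.1 = (reflectVel (normalAt σ N y k) (W h.some.1, W h.some.2)).1 := by
  unfold step normalAt
  rw [dif_pos h, dif_pos h, collidePair_apply_left (some_fst_ne_some_snd h)]

/-- The fold step at the second member of the reflected pair. [folklore] -/
theorem step_apply_some_snd {y : Cfg N} {k : ℕ} (h : (pairsAt σ N y k).Nonempty) (W : Fin (N + 1) → V3) :
    step σ N y W k h.some.2 = (reflectVel (normalAt σ N y k) (W h.some.1, W h.some.2)).2 := by
  unfold step normalAt
  rw [dif_pos h, dif_pos h, collidePair_apply_right]

/-- A fold step that reflects nothing is the identity. [folklore] -/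
theorem step_of_not_nonempty {y : Cfg N} {k : ℕ} (h : ¬ (pairsAt σ N y k).Nonempty) (W : Fin (N + 1) → V3) :
    step σ N y W k = W := by
  unfold step
  rw [dif_neg h]

/-- Particles outside the reflected pair keep their velocity. [folklore] -/
theorem step_apply_of_ne_of_ne {y : Cfg N} {k : ℕ} (h : (pairsAt σ N y k).Nonempty) {i : Fin (N + 1)}
    (h1 : i ≠ h.some.1) (h2 : i ≠ h.some.2) (W : Fin (N + 1) → V3) : step σ N y W k i = W i :=
  step_apply_of_ne (fun _ => ⟨h1, h2⟩) W

/-- **The fold step is additive.** [folklore] -/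
theorem step_add (y : Cfg N) (W₁ W₂ : Fin (N + 1) → V3) (k : ℕ) :
    step σ N y (W₁ + W₂) k = step σ N y W₁ k + step σ N y W₂ k := by
  by_cases h : (pairsAt σ N y k).Nonempty
  · funext i
    rw [Pi.add_apply]
    have hpair : ((W₁ + W₂) h.some.1, (W₁ + W₂) h.some.2) =
        ((W₁ h.some.1, W₁ h.some.2) : V3 × V3) + (W₂ h.some.1, W₂ h.some.2) := rfl
    by_cases h1 : i = h.some.1
    · rw [h1, step_apply_some_fst h, step_apply_some_fst h, step_apply_some_fst h, hpair, reflectVel_add,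
        Prod.fst_add]
    by_cases h2 : i = h.some.2
    · rw [h2, step_apply_some_snd h, step_apply_some_snd h, step_apply_some_snd h, hpair, reflectVel_add,
        Prod.snd_add]
    rw [step_apply_of_ne_of_ne h h1 h2, step_apply_of_ne_of_ne h h1 h2, step_apply_of_ne_of_ne h h1 h2,
      Pi.add_apply]
  · rw [step_of_not_nonempty h, step_of_not_nonempty h, step_of_not_nonempty h]

/-- **The fold step is homogeneous.** [folklore] -/
theorem step_smul (y : Cfg N) (c : ℝ) (W : Fin (N + 1) → V3) (k : ℕ) :
    step σ N y (c • W) k = c • step σ N y W k := by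
  by_cases h : (pairsAt σ N y k).Nonempty
  · funext i
    rw [Pi.smul_apply]
    have hpair : ((c • W) h.some.1, (c • W) h.some.2) = c • ((W h.some.1, W h.some.2) : V3 × V3) := rfl
    by_cases h1 : i = h.some.1
    · rw [h1, step_apply_some_fst h, step_apply_some_fst h, hpair, reflectVel_const_smul, Prod.smul_fst]
    by_cases h2 : i = h.some.2
    · rw [h2, step_apply_some_snd h, step_apply_some_snd h, hpair, reflectVel_const_smul, Prod.smul_snd]
    rw [step_apply_of_ne_of_ne h h1 h2, step_apply_of_ne_of_ne h h1 h2, Pi.smul_apply]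
  · rw [step_of_not_nonempty h, step_of_not_nonempty h]

/-- **The fold step preserves the kinetic energy `Σ_i ‖W i‖²`** (`configEnergy_collidePair`). [folklore] -/
theorem sum_norm_sq_step (y : Cfg N) (W : Fin (N + 1) → V3) (k : ℕ) :
    ∑ i, ‖step σ N y W k i‖ ^ 2 = ∑ i, ‖W i‖ ^ 2 := by
  by_cases h : (pairsAt σ N y k).Nonempty
  · have key := configEnergy_collidePair (G := Torus.geometry (Fin 3)) (some_fst_ne_some_snd h)
      (fun j => ((pre σ N y k j).1, W j))
    unfold configEnergy at key
    have hstep : ∀ i, step σ N y W k i =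
        (collidePair (Torus.geometry (Fin 3)) h.some.1 h.some.2 (fun j => ((pre σ N y k j).1, W j)) i).2 := by
      intro i
      unfold step
      rw [dif_pos h]
    simp_rw [hstep]
    have h2 : (2 : ℝ)⁻¹ ≠ 0 := by norm_num
    simpa using mul_left_cancel₀ h2 key
  · rw [step_of_not_nonempty h]

/-- Folds of steps are additive. [folklore] -/
theorem foldl_step_add (y : Cfg N) (L : List ℕ) (W₁ W₂ : Fin (N + 1) → V3) :
    L.foldl (step σ N y) (W₁ + W₂) = L.foldl (step σ N y) W₁ + L.foldl (step σ N y) W₂ := by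
  induction L generalizing W₁ W₂ with
  | nil => rfl
  | cons k L ih => simp only [List.foldl_cons]; rw [step_add, ih]

/-- Folds of steps are homogeneous. [folklore] -/
theorem foldl_step_smul (y : Cfg N) (L : List ℕ) (c : ℝ) (W : Fin (N + 1) → V3) :
    L.foldl (step σ N y) (c • W) = c • L.foldl (step σ N y) W := by
  induction L generalizing W with
  | nil => rfl
  | cons k L ih => simp only [List.foldl_cons]; rw [step_smul, ih]

/-- Folds of steps preserve the kinetic energy. [folklore] -/
theorem sum_norm_sq_foldl_step (y : Cfg N) (L : List ℕ) (W : Fin (N + 1) → V3) :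
    ∑ i, ‖L.foldl (step σ N y) W i‖ ^ 2 = ∑ i, ‖W i‖ ^ 2 := by
  induction L generalizing W with
  | nil => rfl
  | cons k L ih => simp only [List.foldl_cons]; rw [ih, sum_norm_sq_step]

/-- Folding the same steps in reverse order first is undone by the fold (each step is an involution). [folklore] -/
theorem foldl_step_foldl_reverse (y : Cfg N) (L : List ℕ) (W : Fin (N + 1) → V3) :
    L.foldl (step σ N y) (L.reverse.foldl (step σ N y) W) = W := by
  induction L generalizing W with
  | nil => rfl
  | cons k L ih =>
    simp only [List.reverse_cons, List.foldl_append, List.foldl_cons, List.foldl_nil, step_step]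
    exact ih W

end Step

/-! ## §3 The transfer: linear, energy-preserving, invertible -/

section Transfer

variable {σ : ℝ} {N : ℕ}

/-- **The transfer is additive** (first conjunct of `TransferIsometry` in the landed vocabulary). [folklore] -/
theorem transfer_add (y : Cfg N) (Δ : ℝ) (W₁ W₂ : Fin (N + 1) → V3) :
    transfer σ N y Δ (W₁ + W₂) = transfer σ N y Δ W₁ + transfer σ N y Δ W₂ :=
  foldl_step_add y _ W₁ W₂

/-- **The transfer is homogeneous** (second conjunct of `TransferIsometry`). [folklore] -/
theorem transfer_smul (y : Cfg N) (Δ : ℝ) (c : ℝ) (W : Fin (N + 1) → V3) :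
    transfer σ N y Δ (c • W) = c • transfer σ N y Δ W :=
  foldl_step_smul y _ c W

/-- **The transfer preserves the kinetic energy** (third conjunct of `TransferIsometry`). [folklore] -/
theorem sum_norm_sq_transfer (y : Cfg N) (Δ : ℝ) (W : Fin (N + 1) → V3) :
    ∑ i, ‖transfer σ N y Δ W i‖ ^ 2 = ∑ i, ‖W i‖ ^ 2 :=
  sum_norm_sq_foldl_step y _ W

/-- The inverse transfer: the same reflections folded in reverse order. -/
def untransfer (σ : ℝ) (N : ℕ) (y : Cfg N) (Δ : ℝ) (W : Fin (N + 1) → V3) : Fin (N + 1) → V3 :=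
  (List.range (colls σ N y Δ)).reverse.foldl (step σ N y) W

/-- `transfer ∘ untransfer = id`. [folklore] -/
theorem transfer_untransfer (y : Cfg N) (Δ : ℝ) (W : Fin (N + 1) → V3) :
    transfer σ N y Δ (untransfer σ N y Δ W) = W :=
  foldl_step_foldl_reverse y _ W

/-- The inverse transfer preserves the kinetic energy. [folklore] -/
theorem sum_norm_sq_untransfer (y : Cfg N) (Δ : ℝ) (W : Fin (N + 1) → V3) :
    ∑ i, ‖untransfer σ N y Δ W i‖ ^ 2 = ∑ i, ‖W i‖ ^ 2 :=
  sum_norm_sq_foldl_step y _ W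

end Transfer

/-! ## §4 The `ℓ²` pairing and orthogonality -/

section Pairing

variable {N : ℕ}

/-- The `ℓ²` pairing of two velocity fields: `Σ_i ⟪W i, W' i⟫`. -/
def bil (W W' : Fin (N + 1) → V3) : ℝ := ∑ i, ⟪W i, W' i⟫_ℝ

/-- The pairing is symmetric. [folklore] -/
theorem bil_comm (W W' : Fin (N + 1) → V3) : bil W W' = bil W' W := by
  unfold bil
  exact Finset.sum_congr rfl fun i _ => real_inner_comm _ _

/-- Polarisation: `2 ⟨W, W'⟩ = ‖W + W'‖² − ‖W‖² − ‖W'‖²`. [folklore] -/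
theorem two_mul_bil (W W' : Fin (N + 1) → V3) :
    2 * bil W W' = (∑ i, ‖(W + W') i‖ ^ 2) - (∑ i, ‖W i‖ ^ 2) - ∑ i, ‖W' i‖ ^ 2 := by
  have h : ∑ i, ‖(W + W') i‖ ^ 2 = ∑ i, (‖W i‖ ^ 2 + ‖W' i‖ ^ 2 + 2 * ⟪W i, W' i⟫_ℝ) :=
    Finset.sum_congr rfl fun i _ => by rw [Pi.add_apply, norm_add_sq_real]; ring
  rw [h, Finset.sum_add_distrib, Finset.sum_add_distrib, ← Finset.mul_sum]
  unfold bil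
  ring

/-- An additive, energy-preserving self-map of velocity fields preserves the pairing. [folklore] -/
theorem bil_map_map {f : (Fin (N + 1) → V3) → (Fin (N + 1) → V3)}
    (hadd : ∀ W W', f (W + W') = f W + f W') (hQ : ∀ W, ∑ i, ‖f W i‖ ^ 2 = ∑ i, ‖W i‖ ^ 2)
    (W W' : Fin (N + 1) → V3) : bil (f W) (f W') = bil W W' := by
  have h1 := two_mul_bil (f W) (f W')
  have h2 := two_mul_bil W W'
  rw [← hadd, hQ, hQ, hQ] at h1
  linarith

/-- The pairing with a field concentrated at one particle. [folklore] -/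
theorem bil_single_right' (W : Fin (N + 1) → V3) (i : Fin (N + 1)) (v : V3) :
    bil W (Pi.single i v) = ⟪W i, v⟫_ℝ := by
  unfold bil
  rw [Finset.sum_eq_single i]
  · rw [Pi.single_eq_same]
  · intro j _ hji
    rw [Pi.single_eq_of_ne hji, inner_zero_right]
  · exact fun hi => absurd (Finset.mem_univ i) hi

/-- The pairing with a basis field `e_i ⊗ e_b` reads off a coordinate. [folklore] -/
theorem bil_single_right (W : Fin (N + 1) → V3) (i : Fin (N + 1)) (b : Fin 3) :
    bil W (Pi.single i (EuclideanSpace.single b (1 : ℝ))) = W i b := by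
  rw [bil_single_right', EuclideanSpace.inner_single_right]
  simp

/-- Squared norm in `ℝ³` as the sum of squared coordinates. [folklore] -/
theorem norm_sq_eq_sum_sq (x : V3) : ‖x‖ ^ 2 = ∑ b, x b ^ 2 := by
  rw [EuclideanSpace.norm_eq, Real.sq_sqrt (Finset.sum_nonneg fun _ _ => by positivity)]
  exact Finset.sum_congr rfl fun b _ => by rw [Real.norm_eq_abs, sq_abs]

/-- The energy of a basis field concentrated at one particle. [folklore] -/
theorem sum_norm_sq_single (i : Fin (N + 1)) (v : V3) :
    ∑ k, ‖(Pi.single i v : Fin (N + 1) → V3) k‖ ^ 2 = ‖v‖ ^ 2 := by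
  rw [Finset.sum_eq_single i]
  · rw [Pi.single_eq_same]
  · intro j _ hji
    rw [Pi.single_eq_of_ne hji, norm_zero, zero_pow two_ne_zero]
  · exact fun hi => absurd (Finset.mem_univ i) hi

variable {σ : ℝ}

/-- **Orthogonality of the transfer for the `ℓ²` pairing: `⟨M W, W'⟩ = ⟨W, M⁻¹ W'⟩`.** [folklore] -/
theorem bil_transfer_left (y : Cfg N) (Δ : ℝ) (W W' : Fin (N + 1) → V3) :
    bil (transfer σ N y Δ W) W' = bil W (untransfer σ N y Δ W') := by
  have h := bil_map_map (transfer_add (σ := σ) y Δ) (sum_norm_sq_transfer y Δ) W (untransfer σ N y Δ W')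
  rwa [transfer_untransfer] at h

/-- Matrix entries of `M` are matrix entries of `M⁻¹` transposed:
`(M (e_k ⊗ e_a)) i b = (M⁻¹ (e_i ⊗ e_b)) k a`. [folklore] -/
theorem transfer_single_apply (y : Cfg N) (Δ : ℝ) (k i : Fin (N + 1)) (a b : Fin 3) :
    transfer σ N y Δ (Pi.single k (EuclideanSpace.single a (1 : ℝ))) i b =
      untransfer σ N y Δ (Pi.single i (EuclideanSpace.single b (1 : ℝ))) k a := by
  rw [← bil_single_right (transfer σ N y Δ _) i b, bil_transfer_left, bil_comm, bil_single_right]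

end Pairing

/-! ## §5 The row budget and the range of `ipr` -/

section Budget

variable {σ : ℝ} {N : ℕ}

/-- **ROW BUDGET (F9, proved): `Σ_k Σ_a ‖M (e_k ⊗ e_a) i‖² = 3` for every row `i`** — the fourth conjunct of the
support item `TransferIsometry` (stmt-AtomisticToContinuum-12951) in the landed vocabulary. Row `i` of `M` is row
`i` of the orthogonal matrix `M`, i.e. column `i` of `M⁻¹`, whose energy is that of `e_i ⊗ e_b`, namely `1`, for each
of the three `b`. [folklore] -/
theorem rowBudget (y : Cfg N) (Δ : ℝ) (i : Fin (N + 1)) :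
    ∑ k : Fin (N + 1), ∑ a : Fin 3,
      ‖transfer σ N y Δ (Pi.single k (EuclideanSpace.single a (1 : ℝ))) i‖ ^ 2 = 3 := by
  have h1 : ∀ (k : Fin (N + 1)) (a : Fin 3),
      ‖transfer σ N y Δ (Pi.single k (EuclideanSpace.single a (1 : ℝ))) i‖ ^ 2 =
        ∑ b : Fin 3, untransfer σ N y Δ (Pi.single i (EuclideanSpace.single b (1 : ℝ))) k a ^ 2 := by
    intro k a
    rw [norm_sq_eq_sum_sq]
    exact Finset.sum_congr rfl fun b _ => by rw [transfer_single_apply]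
  have h2 : ∀ b : Fin 3, ∑ k : Fin (N + 1), ∑ a : Fin 3,
      untransfer σ N y Δ (Pi.single i (EuclideanSpace.single b (1 : ℝ))) k a ^ 2 = 1 := by
    intro b
    have h3 : ∑ k : Fin (N + 1), ∑ a : Fin 3,
        untransfer σ N y Δ (Pi.single i (EuclideanSpace.single b (1 : ℝ))) k a ^ 2 =
        ∑ k : Fin (N + 1), ‖untransfer σ N y Δ (Pi.single i (EuclideanSpace.single b (1 : ℝ))) k‖ ^ 2 :=
      Finset.sum_congr rfl fun k _ => (norm_sq_eq_sum_sq _).symm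
    rw [h3, sum_norm_sq_untransfer, sum_norm_sq_single]
    simp
  simp_rw [h1]
  calc ∑ k : Fin (N + 1), ∑ a : Fin 3, ∑ b : Fin 3,
        untransfer σ N y Δ (Pi.single i (EuclideanSpace.single b (1 : ℝ))) k a ^ 2
      = ∑ k : Fin (N + 1), ∑ b : Fin 3, ∑ a : Fin 3,
          untransfer σ N y Δ (Pi.single i (EuclideanSpace.single b (1 : ℝ))) k a ^ 2 :=
        Finset.sum_congr rfl fun k _ => Finset.sum_comm
    _ = ∑ b : Fin 3, ∑ k : Fin (N + 1), ∑ a : Fin 3,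
          untransfer σ N y Δ (Pi.single i (EuclideanSpace.single b (1 : ℝ))) k a ^ 2 := Finset.sum_comm
    _ = ∑ _b : Fin 3, (1 : ℝ) := Finset.sum_congr rfl fun b _ => h2 b
    _ = 3 := by simp

/-- The block weights `a_ik = Σ_a ‖M (e_k ⊗ e_a) i‖²` are nonnegative. [folklore] -/
theorem blockWeight_nonneg (y : Cfg N) (Δ : ℝ) (i k : Fin (N + 1)) :
    0 ≤ ∑ a : Fin 3, ‖transfer σ N y Δ (Pi.single k (EuclideanSpace.single a (1 : ℝ))) i‖ ^ 2 :=
  Finset.sum_nonneg fun _ _ => sq_nonneg _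

/-- **THE FLOOR (tightness of the target): `rowIpr_i ≥ 9/(N+1)`** (Cauchy–Schwarz on the row budget). The crux's
`ipr → 0` can be approached at best at the Haar rate `9/(N+1)` (complete equidistribution of every row). [folklore] -/
theorem floor_le_rowIpr (y : Cfg N) (Δ : ℝ) (i : Fin (N + 1)) :
    9 / ((N + 1 : ℕ) : ℝ) ≤ rowIpr σ N y Δ i := by
  have hN : (0 : ℝ) < ((N + 1 : ℕ) : ℝ) := by positivity
  have hcs := sq_sum_le_card_mul_sum_sq (s := (Finset.univ : Finset (Fin (N + 1))))
    (f := fun k => ∑ a : Fin 3, ‖transfer σ N y Δ (Pi.single k (EuclideanSpace.single a (1 : ℝ))) i‖ ^ 2)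
  rw [rowBudget, Finset.card_univ, Fintype.card_fin] at hcs
  rw [div_le_iff₀ hN]
  unfold rowIpr
  linarith

/-- `rowIpr_i ≤ 9` (`Σ a² ≤ (Σ a)²` for nonnegative weights). [folklore] -/
theorem rowIpr_le_nine (y : Cfg N) (Δ : ℝ) (i : Fin (N + 1)) : rowIpr σ N y Δ i ≤ 9 := by
  have h := Finset.sum_sq_le_sq_sum_of_nonneg (s := (Finset.univ : Finset (Fin (N + 1))))
    (f := fun k => ∑ a : Fin 3, ‖transfer σ N y Δ (Pi.single k (EuclideanSpace.single a (1 : ℝ))) i‖ ^ 2)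
    (fun k _ => blockWeight_nonneg y Δ i k)
  rw [rowBudget] at h
  unfold rowIpr
  linarith

/-- A mean of `N + 1` numbers in `[lo, hi]` lies in `[lo, hi]`. [folklore] -/
theorem mean_mem_Icc {lo hi : ℝ} {f : Fin (N + 1) → ℝ} (hlo : ∀ i, lo ≤ f i) (hhi : ∀ i, f i ≤ hi) :
    lo ≤ ((N + 1 : ℕ) : ℝ)⁻¹ * ∑ i, f i ∧ ((N + 1 : ℕ) : ℝ)⁻¹ * ∑ i, f i ≤ hi := by
  have hN : (0 : ℝ) < ((N + 1 : ℕ) : ℝ) := by positivity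
  have hc : ∀ c : ℝ, ∑ _i : Fin (N + 1), c = ((N + 1 : ℕ) : ℝ) * c := fun c => by
    rw [Finset.sum_const, Finset.card_univ, Fintype.card_fin, nsmul_eq_mul]
  have hk : ∀ c : ℝ, ((N + 1 : ℕ) : ℝ)⁻¹ * (((N + 1 : ℕ) : ℝ) * c) = c := fun c => by
    rw [← mul_assoc, inv_mul_cancel₀ hN.ne', one_mul]
  constructor
  · rw [← hk lo, ← hc lo]
    exact mul_le_mul_of_nonneg_left (Finset.sum_le_sum fun i _ => hlo i) (inv_nonneg.2 hN.le)
  · rw [← hk hi, ← hc hi]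
    exact mul_le_mul_of_nonneg_left (Finset.sum_le_sum fun i _ => hhi i) (inv_nonneg.2 hN.le)

/-- **`ipr ≥ 9/(N+1)`.** [folklore] -/
theorem floor_le_ipr (y : Cfg N) (Δ : ℝ) : 9 / ((N + 1 : ℕ) : ℝ) ≤ ipr σ N y Δ :=
  (mean_mem_Icc (floor_le_rowIpr (σ := σ) y Δ) (rowIpr_le_nine y Δ)).1

/-- **`ipr ≤ 9`**: the crux's functional is bounded, so the entropy-transfer inequality applies to it. [folklore] -/
theorem ipr_le_nine (y : Cfg N) (Δ : ℝ) : ipr σ N y Δ ≤ 9 :=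
  (mean_mem_Icc (floor_le_rowIpr (σ := σ) y Δ) (rowIpr_le_nine y Δ)).2

/-- **UNIT SWAP (proved): at every fold step the normal components of a row's blocks sum to one.** For every row `p`,
every unit vector `ν` and every window, `Σ_k Σ_a ⟪ν, M (e_k ⊗ e_a) p⟫² = 1`: the transferred weights
`x_k = ‖P_ν M_pk‖_F²` of the kinship / gossip bookkeeping form a probability vector over the sources `k`, whatever the
history (row `p` of the orthogonal `M` paired with the unit field `ν ⊗ δ_p`). [folklore] -/
theorem sum_inner_sq_transfer_eq_one (y : Cfg N) (Δ : ℝ) (p : Fin (N + 1)) {ν : V3} (hν : ‖ν‖ = 1) :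
    ∑ k : Fin (N + 1), ∑ a : Fin 3,
      ⟪ν, transfer σ N y Δ (Pi.single k (EuclideanSpace.single a (1 : ℝ))) p⟫_ℝ ^ 2 = 1 := by
  have h1 : ∀ (k : Fin (N + 1)) (a : Fin 3),
      ⟪ν, transfer σ N y Δ (Pi.single k (EuclideanSpace.single a (1 : ℝ))) p⟫_ℝ =
        untransfer σ N y Δ (Pi.single p ν) k a := by
    intro k a
    rw [real_inner_comm, ← bil_single_right' (transfer σ N y Δ _) p ν, bil_transfer_left, bil_comm,
      bil_single_right]
  simp_rw [h1]
  have h3 : ∑ k : Fin (N + 1), ∑ a : Fin 3, untransfer σ N y Δ (Pi.single p ν) k a ^ 2 =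
      ∑ k : Fin (N + 1), ‖untransfer σ N y Δ (Pi.single p ν) k‖ ^ 2 :=
    Finset.sum_congr rfl fun k _ => (norm_sq_eq_sum_sq _).symm
  rw [h3, sum_norm_sq_untransfer, sum_norm_sq_single, hν, one_pow]

end Budget

end

end Summit.AtomisticToContinuum.HydrodynamicLimit.Theorems.DiffuseBackwardInfluenceNeg
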